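import Mathlib.NumberTheory.LSeries.HurwitzZetaValues
import Mathlib.NumberTheory.LSeries.DirichletContinuation
import Mathlib.NumberTheory.Bernoulli
import Mathlib.NumberTheory.BernoulliPolynomials
import Mathlib.NumberTheory.Padics.PadicNumbers
import HarnessLib

/-!
# Generalized Bernoulli numbers `B_{k,χ}`: the value `L(1 - k, χ) = -B_{k,χ}/k` and
# `p`-integrality for `p > k + 1`, `p ∤ N`

Topic `Literature/NumberTheory/LFunctions`.  One definition (with a body) and theorems; no named
facts.

For a function / Dirichlet character `χ` on `ℤ/Nℤ` the **Bernoulli numbers of `χ`** are defined by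
the generating function `∑_{c=0}^{N-1} χ(c) t e^{ct}/(e^{Nt} - 1) = ∑_k B_{k,χ} t^k/k!`
(Diamond–Shurman (4.29); Billerey–Menares (1), Washington §4.1), equivalently (Diamond–Shurman
(4.30), Washington Prop. 4.1) by the closed formula in Bernoulli polynomials

  `B_{k,χ} = N^{k-1} ∑_{c=0}^{N-1} χ(c) B_k(c/N)`.

We take (4.30) as the DEFINITION (`generalizedBernoulli`, with the rational weights
`genBernoulliCoeff k N c = N^{k-1} B_k(c/N)` kept separate so that integrality statements are
statements about rational numbers) and prove:

* `dirichletLFunction_one_sub_nat` — **`L(1 - k, χ) = -B_{k,χ}/k` for `k ≥ 2`**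
  (Diamond–Shurman §4.7, p. 137; Washington Thm. 4.2), from Mathlib's values of the Hurwitz zeta
  function at negative integers (`HurwitzZeta.hurwitzZeta_neg_nat`) and the definition of
  `DirichletCharacter.LFunction` as `N^{-s} ∑_j χ(j) ζ(s, j/N)`.  (The case `k = 1`, `L(0, χ)`,
  where Mathlib's lemma does not apply, is the tree's `DirichletLAtZero`.)
* `generalizedBernoulli_eq_zero_of_even`, `…_of_odd` — `B_{k,χ} = 0` when `χ(-1) ≠ (-1)^k`
  (`k ≥ 2`), from the trivial zeros of `L(s, χ)`.
* `padicValuation_bernoulli_le_one` — `B_i` is `p`-integral for `i < p - 1` (von Staudt–Clausen,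
  Mathlib `bernoulli.vonStaudt_clausen`), and hence
  `padicValuation_genBernoulliCoeff_le_one` — **the weights `N^{k-1} B_k(c/N)` are `p`-integral
  when `p ∤ N` and `k < p - 1`**: expanding `B_k(x) = ∑ binom(k,i) B_{k-i} x^i`, every term
  `binom(k,i) B_{k-i} c^i N^{k-1-i}` is `p`-integral (the term `i = k` carries `N^{-1}`).  This is
  the integrality `B_{k,ψ} ∈ ℤ̄_w` of Billerey–Menares 2018, Lemma 3 (there via Carlitz's
  theorem), for `l > k + 1`, `l ∤ 𝔣`, in the form "`B_{k,χ}` is a `ℤ_{(p)}`-linear combination of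
  the values of `χ`" (`generalizedBernoulli_eq_sum`), which is what reduction modulo a place
  above `p` uses.
* `generalizedBernoulli_modOne` — `B_{k,𝟙₁} = B_k` (Mathlib's `bernoulli`, `B₁ = -1/2`; the
  generating function (4.29) gives `+1/2` at `k = 1`, the only discrepancy, irrelevant for
  `k ≥ 2`).

Deliberately NOT here: the generating-function identity (4.29) ⇔ (4.30) itself, Carlitz's sharper
denominators theorem, `B_{k,χ} ≠ 0` for `χ(-1) = (-1)^k`.

## References

* F. Diamond, J. Shurman, *A First Course in Modular Forms*, GTM 228 (2005), §4.7, (4.29)–(4.30)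
  (p. 135) and `L(1-k,ψ) = -B_{k,ψ}/k` (p. 137). [DiamondShurman2005]
* L. C. Washington, *Introduction to Cyclotomic Fields*, 2nd ed., GTM 83 (1997), Prop. 4.1,
  Thm. 4.2. [Washington1997]
* N. Billerey, R. Menares, *Strong modularity of reducible Galois representations*, Trans. AMS 370
  (2018), §1.1–1.2, Lemma 3. [BillereyMenares2018]
-/

noncomputable section

open Finset WithZero HurwitzZeta

namespace Literature.NumberTheory.LFunctions

/-! ### Definition -/

/-- The rational weight `N^{k-1} B_k(c/N)` (`B_k(X)` the Bernoulli polynomial, Mathlib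
`Polynomial.bernoulli`) of the value `χ(c)` in the generalized Bernoulli number
`B_{k,χ} = N^{k-1} ∑_{c=0}^{N-1} χ(c) B_k(c/N)` (the power is an integer power, `N^{-1}` for
`k = 0`). [cite: DiamondShurman2005, §4.7 (4.30), p. 135] -/
def genBernoulliCoeff (k N c : ℕ) : ℚ :=
  (N : ℚ) ^ ((k : ℤ) - 1) * (Polynomial.bernoulli k).eval ((c : ℚ) / N)

/-- The **generalized Bernoulli number** (Bernoulli number of `χ`)
`B_{k,χ} = N^{k-1} ∑_{c=0}^{N-1} χ(c) B_k(c/N)` of a Dirichlet character `χ` modulo `N` with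
values in a `ℚ`-algebra `R` (Diamond–Shurman (4.30); equivalently defined by the generating
function `∑_{c=0}^{N-1} χ(c) t e^{ct}/(e^{Nt}-1) = ∑_k B_{k,χ} t^k/k!`, op. cit. (4.29),
Billerey–Menares 2018 (1)).  The sum runs over `j : ZMod N` through the representatives
`j.val ∈ {0, …, N-1}`. [cite: DiamondShurman2005, §4.7 (4.29)–(4.30), p. 135] -/
def generalizedBernoulli {R : Type*} [CommRing R] [Algebra ℚ R] {N : ℕ} [NeZero N] (k : ℕ)
    (χ : DirichletCharacter R N) : R :=
  ∑ j : ZMod N, χ j * algebraMap ℚ R (genBernoulliCoeff k N j.val)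

section Basic

variable {R : Type*} [CommRing R] [Algebra ℚ R] {N : ℕ} [NeZero N]

/-- Unfolding: `B_{k,χ} = ∑_j χ(j) · (N^{k-1} B_k(j/N))`, a linear combination of the values of
`χ` with the rational coefficients `genBernoulliCoeff`. [folklore] -/
theorem generalizedBernoulli_eq_sum (k : ℕ) (χ : DirichletCharacter R N) :
    generalizedBernoulli k χ =
      ∑ j : ZMod N, χ j * algebraMap ℚ R (genBernoulliCoeff k N j.val) :=
  rfl

/-- For `k ≥ 1` the weight is `N^{k-1} B_k(c/N)` with a natural-number power. [folklore] -/
theorem genBernoulliCoeff_of_one_le {k : ℕ} (hk : 1 ≤ k) (N c : ℕ) :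
    genBernoulliCoeff k N c = (N : ℚ) ^ (k - 1) * (Polynomial.bernoulli k).eval ((c : ℚ) / N) := by
  unfold genBernoulliCoeff
  congr 1
  rw [← zpow_natCast]
  congr 1
  push_cast [Nat.cast_sub hk]
  ring

/-- The trivial character modulo `1`: `B_{k,𝟙₁} = B_k` (Mathlib's `bernoulli`, with
`B₁ = -1/2`). [cite: DiamondShurman2005, §4.7, p. 135] -/
theorem generalizedBernoulli_modOne (k : ℕ) (χ : DirichletCharacter R 1) :
    generalizedBernoulli k χ = algebraMap ℚ R (bernoulli k) := by
  unfold generalizedBernoulli genBernoulliCoeff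
  rw [Fintype.sum_subsingleton _ (0 : ZMod 1)]
  have hχ : χ (0 : ZMod 1) = 1 := by
    rw [show (0 : ZMod 1) = 1 from Subsingleton.elim _ _, map_one]
  rw [hχ, one_mul, ZMod.val_zero]
  simp [Polynomial.bernoulli_eval_zero]

end Basic

/-! ### `L(1 - k, χ) = -B_{k,χ} / k` -/

section LValue

variable {N : ℕ} [NeZero N]

omit [NeZero N] in
/-- The complex value of the weight: `N^{k-1} B_k(c/N)` computed in `ℂ` with the Bernoulli
polynomial mapped to `ℂ[X]`. [folklore] -/
theorem algebraMap_genBernoulliCoeff {k : ℕ} (hk : 1 ≤ k) (c : ℕ) :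
    (algebraMap ℚ ℂ) (genBernoulliCoeff k N c) =
      (N : ℂ) ^ (k - 1) * ((Polynomial.bernoulli k).map (algebraMap ℚ ℂ)).eval ((c : ℂ) / N) := by
  rw [genBernoulliCoeff_of_one_le hk, map_mul, map_pow, map_natCast, Polynomial.eval_map,
    ← Polynomial.eval₂_at_apply]
  congr 1
  rw [map_div₀, map_natCast, map_natCast]

/-- **`L(1 - k, χ) = -B_{k,χ}/k`** for a Dirichlet character `χ` modulo `N` and an integer `k ≥ 2`
(Diamond–Shurman §4.7, p. 137: "`L(1-k,ψ) = -B_{k,ψ}/k` for `k ≥ 1`"; Washington Thm. 4.2).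
Proof: `L(s, χ) = N^{-s} ∑_j χ(j) ζ(s, j/N)` (Mathlib's definition) and
`ζ(1-k, x) = -B_k(x)/k` for `x ∈ [0, 1]`, `k ≥ 2` (`HurwitzZeta.hurwitzZeta_neg_nat`).
[cite: DiamondShurman2005, §4.7, p. 137] -/
theorem dirichletLFunction_one_sub_nat (χ : DirichletCharacter ℂ N) {k : ℕ}
    (hk : 2 ≤ k) :
    χ.LFunction (1 - k) = -(generalizedBernoulli k χ) / k := by
  have hk1 : (k - 1 : ℕ) ≠ 0 := by omega
  have hs : (1 - (k : ℂ)) = -((k - 1 : ℕ) : ℂ) := by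
    push_cast [Nat.cast_sub (show 1 ≤ k by omega)]
    ring
  rw [DirichletCharacter.LFunction, ZMod.LFunction, hs, neg_neg, Complex.cpow_natCast]
  have hj : ∀ j : ZMod N, hurwitzZeta (ZMod.toAddCircle j) (-((k - 1 : ℕ) : ℂ)) =
      -1 / ((k - 1 : ℕ) + 1) *
        ((Polynomial.bernoulli (k - 1 + 1)).map (algebraMap ℚ ℂ)).eval
          (((j.val : ℝ) / N : ℝ) : ℂ) := by
    intro j
    rw [ZMod.toAddCircle_apply]
    refine HurwitzZeta.hurwitzZeta_neg_nat hk1 ⟨by positivity, ?_⟩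
    exact div_le_one_of_le₀ (by exact_mod_cast (ZMod.val_lt j).le) (by positivity)
  have hk' : k - 1 + 1 = k := by omega
  have hkc : ((k - 1 : ℕ) : ℂ) + 1 = k := by
    push_cast [Nat.cast_sub (show 1 ≤ k by omega)]
    ring
  simp_rw [hj, hk', hkc, generalizedBernoulli_eq_sum,
    algebraMap_genBernoulliCoeff (show 1 ≤ k by omega), Complex.ofReal_div, Complex.ofReal_natCast]
  rw [← Finset.sum_neg_distrib, Finset.sum_div, Finset.mul_sum]
  refine Finset.sum_congr rfl fun j _ ↦ ?_
  ring

/-- `B_{k,χ} = 0` for an EVEN character and ODD `k ≥ 3` (the parity condition `χ(-1) ≠ (-1)^k`;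
Billerey–Menares 2018, proof of Lemma 3: "if `ψ(-1) ≠ (-1)^k`, then `B_{k,ψ} = 0`"), from the
trivial zero `L(1 - k, χ) = 0`. [cite: BillereyMenares2018, Lemma 3 (proof)] -/
theorem generalizedBernoulli_eq_zero_of_even (χ : DirichletCharacter ℂ N) (hχ : χ.Even) {k : ℕ}
    (hk : 2 ≤ k) (hko : Odd k) : generalizedBernoulli k χ = 0 := by
  obtain ⟨r, hr⟩ := hko
  obtain ⟨n, rfl⟩ : ∃ n, r = n + 1 := ⟨r - 1, by omega⟩
  have h := dirichletLFunction_one_sub_nat χ hk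
  have hs : (1 - (k : ℂ)) = -(2 * ((n : ℂ) + 1)) := by
    rw [hr]
    push_cast
    ring
  rw [hs, hχ.LFunction_neg_two_mul_nat_add_one n, eq_comm, div_eq_zero_iff, neg_eq_zero] at h
  exact h.resolve_right (by exact_mod_cast (show k ≠ 0 by omega))

/-- `B_{k,χ} = 0` for an ODD character and EVEN `k ≥ 2` (parity `χ(-1) ≠ (-1)^k`), from the
trivial zero `L(1 - k, χ) = 0`. [cite: BillereyMenares2018, Lemma 3 (proof)] -/
theorem generalizedBernoulli_eq_zero_of_odd (χ : DirichletCharacter ℂ N) (hχ : χ.Odd) {k : ℕ}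
    (hk : 2 ≤ k) (hke : Even k) : generalizedBernoulli k χ = 0 := by
  obtain ⟨r, hr⟩ := hke
  obtain ⟨n, rfl⟩ : ∃ n, r = n + 1 := ⟨r - 1, by omega⟩
  have h := dirichletLFunction_one_sub_nat χ hk
  have hs : (1 - (k : ℂ)) = -(2 * (n : ℂ)) - 1 := by
    rw [hr]
    push_cast
    ring
  rw [hs, hχ.LFunction_neg_two_mul_nat_sub_one n, eq_comm, div_eq_zero_iff, neg_eq_zero] at h
  exact h.resolve_right (by exact_mod_cast (show k ≠ 0 by omega))

end LValue

/-! ### `p`-integrality for `p > k + 1`, `p ∤ N` (Billerey–Menares 2018, Lemma 3) -/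

section Integrality

variable {p : ℕ} [Fact p.Prime]

/-- A natural number has `p`-adic valuation `≤ 1`. [folklore] -/
theorem padicValuation_natCast_le_one (n : ℕ) : Rat.padicValuation p (n : ℚ) ≤ 1 := by
  rw [← Int.cast_natCast, Rat.padicValuation_cast]
  exact Int.padicValuation_le_one p n

/-- A natural number prime to `p` has `p`-adic valuation `1`. [folklore] -/
theorem padicValuation_natCast_eq_one {n : ℕ} (hn : ¬ p ∣ n) : Rat.padicValuation p (n : ℚ) = 1 := by
  rw [← Int.cast_natCast, Rat.padicValuation_cast, Int.padicValuation_eq_one_iff,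
    Int.natCast_dvd_natCast]
  exact hn

/-- **von Staudt–Clausen, integrality half**: the Bernoulli number `B_i` is `p`-integral whenever
`i < p - 1` (for even `i > 0`, `B_i + ∑_{(q-1) ∣ i} 1/q ∈ ℤ` with every such prime `q ≤ i + 1 < p`;
`B_0 = 1`, `B_1 = -1/2` with `p` odd, `B_i = 0` for odd `i > 1`). [folklore] -/
theorem padicValuation_bernoulli_le_one {i : ℕ} (hi : i < p - 1) :
    Rat.padicValuation p (bernoulli i) ≤ 1 := by
  classical
  rcases Nat.even_or_odd i with hev | hod
  · obtain ⟨m, rfl⟩ : ∃ m, i = 2 * m := ⟨i / 2, by obtain ⟨a, rfl⟩ := hev; omega⟩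
    rcases Nat.eq_zero_or_pos m with rfl | hm
    · simp [_root_.bernoulli_zero]
    · obtain ⟨T, hT⟩ := Bernoulli.vonStaudt_clausen m
      set P : Finset ℕ :=
        (Finset.range (2 * m + 2)).filter fun q ↦ q.Prime ∧ (q - 1) ∣ 2 * m with hPdef
      have hB : bernoulli (2 * m) = (T : ℚ) - ∑ q ∈ P, (1 : ℚ) / q := by
        linear_combination hT.symm
      rw [hB]
      refine Valuation.map_sub_le _ ?_ (Valuation.map_sum_le _ fun q hq ↦ ?_)
      · rw [Rat.padicValuation_cast]
        exact Int.padicValuation_le_one p T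
      · obtain ⟨-, hqprime, hqdvd⟩ := Finset.mem_filter.mp hq
        have hq1 : q - 1 ≤ 2 * m := Nat.le_of_dvd (by omega) hqdvd
        have hqp : ¬ p ∣ q := by
          intro h
          have := (Nat.prime_dvd_prime_iff_eq Fact.out hqprime).mp h
          omega
        rw [one_div, map_inv₀, padicValuation_natCast_eq_one hqp, inv_one]
  · by_cases hi1 : i = 1
    · subst hi1
      have hp2 : ¬ p ∣ 2 := by
        intro h
        have := (Nat.prime_dvd_prime_iff_eq Fact.out Nat.prime_two).mp h
        omega
      rw [_root_.bernoulli_one, map_div₀, Valuation.map_neg, map_one,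
        show (2 : ℚ) = ((2 : ℕ) : ℚ) by norm_num, padicValuation_natCast_eq_one hp2, div_one]
    · obtain ⟨r, hr⟩ := hod
      rw [bernoulli_eq_zero_of_odd ⟨r, hr⟩ (by omega), map_zero]
      exact bot_le

/-- **The weights `N^{k-1} B_k(c/N)` are `p`-integral for `p ∤ N`, `k < p - 1`** (expanding
`B_k(c/N) = ∑_i binom(k,i) B_{k-i} (c/N)^i`, each term `binom(k,i) B_{k-i} c^i N^{k-1-i}` is
`p`-integral by `padicValuation_bernoulli_le_one`; the term `i = k` is `c^k/N`).  With
`generalizedBernoulli_eq_sum` this is the `w`-integrality of `B_{k,ψ}` for `l > k + 1`, `l ∤ 𝔣₀`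
of Billerey–Menares 2018, Lemma 3 (proved there through Carlitz's theorem).
[cite: BillereyMenares2018, Lemma 3] -/
theorem padicValuation_genBernoulliCoeff_le_one {k N : ℕ} (hN : ¬ p ∣ N) (hk : k < p - 1)
    (c : ℕ) : Rat.padicValuation p (genBernoulliCoeff k N c) ≤ 1 := by
  unfold genBernoulliCoeff
  rw [Polynomial.bernoulli_def, Polynomial.eval_finsetSum, Finset.mul_sum]
  refine Valuation.map_sum_le _ fun i hi ↦ ?_
  rw [Finset.mem_range] at hi
  rw [Polynomial.eval_monomial]
  simp only [map_mul, map_pow, map_div₀, map_zpow₀, padicValuation_natCast_eq_one hN, one_zpow,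
    one_mul, div_one]
  exact mul_le_one' (mul_le_one' (padicValuation_bernoulli_le_one (by omega))
    (padicValuation_natCast_le_one _)) (pow_le_one' (padicValuation_natCast_le_one c) _)

/-- **Billerey–Menares 2018, Lemma 3 (integrality of `B_{k,ψ}` at a place above `p`, for
`p > k + 1`, `p ∤ 𝔣₀`)**, in the form: `B_{k,χ}` lies in any subring containing the values of `χ`
and the images of the `p`-integral rationals (e.g. the local ring of a place above `p`).
[cite: BillereyMenares2018, Lemma 3] -/
theorem generalizedBernoulli_mem_subring {R : Type*} [CommRing R] [Algebra ℚ R] {N : ℕ}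
    [NeZero N] {k : ℕ} (χ : DirichletCharacter R N) (S : Subring R) (hχ : ∀ j, χ j ∈ S)
    (hS : ∀ q : ℚ, Rat.padicValuation p q ≤ 1 → algebraMap ℚ R q ∈ S) (hN : ¬ p ∣ N)
    (hk : k < p - 1) : generalizedBernoulli k χ ∈ S := by
  rw [generalizedBernoulli_eq_sum]
  exact Subring.sum_mem _ fun j _ ↦
    Subring.mul_mem _ (hχ j) (hS _ (padicValuation_genBernoulliCoeff_le_one hN hk _))

end Integrality

/-! ### Weight `2`: `N · B_{2,χ} = ∑ χ(c)(c² − N c)` for `χ ≠ 𝟙` -/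

section WeightTwo

variable {R : Type*} [CommRing R] [Algebra ℚ R] {N : ℕ} [NeZero N]

/-- The weight-2 coefficient: `N · (N^{2−1} B₂(c/N)) = c² − N c + N²/6`.
[cite: Lang1990, Ch. 2 §2, formula B 7 («B_{k,f} = N^{k−1} Σ_{a=0}^{N−1} f(a) 𝐁_k(⟨a/N⟩)») with k = 2] -/
theorem natCast_mul_genBernoulliCoeff_two (c : ℕ) :
    (N : ℚ) * genBernoulliCoeff 2 N c = (c : ℚ) ^ 2 - (N : ℚ) * c + (N : ℚ) ^ 2 / 6 := by
  have hN : (N : ℚ) ≠ 0 := by exact_mod_cast NeZero.ne N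
  -- `B₂(x) = x² − x + 1/6` (also `Literature.NumberTheory.ModularForms.bernoulli_two_eval` in
  -- `SiegelUnitsEisenstein.lean`, not importable here without a cycle risk; re-derived inline)
  have hB : (Polynomial.bernoulli 2).eval ((c : ℚ) / N) = ((c : ℚ) / N) ^ 2 - (c : ℚ) / N + 1 / 6 := by
    rw [Polynomial.bernoulli_def]
    simp only [Finset.sum_range_succ, Finset.sum_range_zero, Polynomial.eval_add,
      Polynomial.eval_monomial]
    norm_num
    ring
  rw [genBernoulliCoeff_of_one_le (by norm_num : 1 ≤ 2), hB]
  field_simp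
  ring

/-- **Weight 2, non-trivial character: `N · B_{2,χ} = ∑_{c mod N} χ(c) (c² − N c)`** (the term
`(N²/6)·∑ χ(c)` vanishes by orthogonality for `χ ≠ 𝟙`), with `c` running through the
representatives `0 ≤ c < N`. This is the specialization `k = 2` of the defining formula
`B_{k,χ} = N^{k−1} ∑_{a=0}^{N−1} χ(a) B_k(a/N)` [Lang1990, Ch. 2 §2, B 7] = [DiamondShurman2005,
(4.30)]; it is the shape in which `N·B_{2,ε}` enters the `λ`-adic criterion of
`Literature/NumberTheory/ModularForms/MerelBernoulliCriterion.lean` (`∑ ε(a)(a² − N a)`) and the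
`ζ`-element of Wake–Wang-Erickson (`∑ B₂(⌊i/N⌋)[i]`). Proved here.
[cite: Lang1990, Ch. 2 §2, formula B 7 (k = 2)] -/
theorem natCast_mul_generalizedBernoulli_two [IsDomain R] (χ : DirichletCharacter R N)
    (hχ : χ ≠ 1) :
    (N : R) * generalizedBernoulli 2 χ =
      ∑ j : ZMod N, χ j * (((j.val : ℕ) : R) ^ 2 - (N : R) * ((j.val : ℕ) : R)) := by
  rw [generalizedBernoulli_eq_sum, Finset.mul_sum]
  have key : ∀ j : ZMod N, (N : R) * (χ j * algebraMap ℚ R (genBernoulliCoeff 2 N j.val)) =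
      χ j * (((j.val : ℕ) : R) ^ 2 - (N : R) * ((j.val : ℕ) : R)) +
        algebraMap ℚ R ((N : ℚ) ^ 2 / 6) * χ j := by
    intro j
    have h := congrArg (algebraMap ℚ R) (natCast_mul_genBernoulliCoeff_two (N := N) j.val)
    rw [map_mul, map_natCast] at h
    rw [← mul_assoc, mul_comm (N : R) (χ j), mul_assoc, h]
    simp only [map_add, map_sub, map_mul, map_pow, map_natCast]
    ring
  simp_rw [key]
  rw [Finset.sum_add_distrib, ← Finset.mul_sum, MulChar.sum_eq_zero_of_ne_one hχ, mul_zero,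
    add_zero]

end WeightTwo

end Literature.NumberTheory.LFunctions
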